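import Summits.BirchSwinnertonDyer.BirchSwinnertonDyer.Theorems.GenusKolyvaginAtTwoGenusPrimitiveSupplyAtTwoArchimedeanDescAdmissible
import Summits.BirchSwinnertonDyer.BirchSwinnertonDyer.Theorems.GenusKolyvaginAtTwoPowDvdShaCardAtTwoRTLocalKernelHeegnerUnramified
import Summits.BirchSwinnertonDyer.Rank1Residual.F1Sign2.TwistSelmerRelaxedAtInfinityAtTwo
import Literature.NumberTheory.EllipticCurves.SelmerTorsionRestriction
import Literature.NumberTheory.EllipticCurves.ArchimedeanLocalConditionTorsion
import Literature.NumberTheory.EllipticCurves.LocalTorsionCohomologyCoprime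
import Literature.NumberTheory.EllipticCurves.CasselsTateSelmerKolyvaginValue
import Literature.NumberTheory.EllipticCurves.HeegnerFieldOfDiscriminantProofs
import Literature.NumberTheory.QuadraticFields.KroneckerSplitting
import Literature.Barriers.BirchSwinnertonDyer.DescentDefectUnboundedMatsunoCor33Proofs
import HarnessLib

/-!
# Route `GenusKolyvaginAtTwo`, crux #2 `GenusPrimitiveSupplyAtTwo` (stmt-BirchSwinnertonDyer-22136):
# EXACT DESCENT OF THE FINITE `2`-SELMER CONDITIONS ALONG AN ADMISSIBLE IMAGINARY QUADRATIC FIELD —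
# `res_K x ∈ Sel₂(E_K/K) ⟹ x ∈ Sel₂^{rel ∞}(E)` for `K = ℚ(√d)`, `d` descent-admissible

Width seat `bsd-line-gk2-p5` g17 (cell `bsd-f1-sign2`, SUPPLY lineage of crux 22136), file 49 of the series; sequel of files 47/48
(AN-10K BY NAME; corestriction kills the real place) and of file 25 (`…ArchimedeanDescAdmissible`: the finite place menu of a
descent-admissible `d`). THEOREMS ONLY (no definition, no named fact, no `sorry`, no local instance); helper
`--supports stmt-BirchSwinnertonDyer-22136`; no item is closed; BSD is not proved by any of this.

WHAT. The converse inclusion to file 47 §200 (`res_K Sel₂^{rel ∞}(W) ⊆ Sel₂(E_K/K)` for `K` totally complex): for `W/ℚ` globally minimal,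
`d` with `F1Sign2.DescAdmissible W d` and `K ∋ √d` quadratic, a class `x ∈ H¹(ℚ, E[2])` whose restriction satisfies the Selmer condition
of `E_K` at every finite place of `K` satisfies `W`'s Selmer condition at every finite place of `ℚ` — so
`res_K⁻¹ Sel₂(E_K/K) = Sel₂^{rel ∞}(W)` (the `Gal(K/ℚ)`-invariant part of `Sel₂(E_K/K)` IS the ∞-relaxed Selmer group, Kramer 1981 Thm. 1):

* §206 `mem_selmerLocalKer_adicCompletion_iff_resTorsion_mem` — bridge: the condition of `E_K` at `K_w` for `res_K x` is the vanishing
  of `x` in `H¹(K_w, E)` for the `ℚ`-field `K_w` (the currency of gk2-p3's place-by-place dictionary `…RTLocalKernelHeegnerUnramified`).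
* §207 `mem_selmerLocalKer_of_natCard_ker_eq_one` — at an odd prime with `E(ℚ_p)[2] = 0`, `H¹(ℚ_p, E[2]) = 0` (`#H¹ = #E(ℚ_p)[2]²`, Milne
  I 2.8/2.3), so every class satisfies the condition; **`mem_selmerGroupRelaxedAtInfinityAtTwo_of_forall_mem_selmerLocalKer`** and
  **`…_of_resTorsion_mem_selmerGroup`** — the exact descent, place by place: `p ∣ d` silent (`a_p` odd ⟺ no `2`-torsion mod `p`, file 7
  `GenusKolyTwin.silent_iff_odd_frobeniusTrace`), `p ∤ d` good ⟹ unramified in `K` (`d_K = d` odd; gk2-p3 g17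
  `selmerLocalKer_adicCompletion_eq_of_not_dvd_discr`, Milne I 3.8), `p ∤ d` bad ⟹ split in `K` (`d ≡ 1 (8)`, `(d/p) = 1`; Kronecker,
  `selmerLocalKer_adicCompletion_eq_of_ncard_primesOver_eq_two`).

Honest framing: Kramer 1981 Thm. 1 / Dokchitser–Dokchitser Lemma 4.14 local bookkeeping at the places where the local term vanishes, assembled
for the cell's `DescAdmissible`; kernel-new; beyond-print theorem: no. Crux 22136 stays OPEN exactly at (U) 24947 ∧ (CONV₂) 19220/24948.
BSD is not proved by any of this.

References: [Kramer1981] §2 Prop. 3, Thm. 1; [MilneADT2006] I Cor. 2.3, Thm. 2.8, Prop. 3.8; [DokchitserDokchitserAnnals2010] Lemma 4.14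
(proof); [MazurRubin2010] Lemma 2.11; Marcus, *Number Fields*, Ch. 3 Thm. 25.
-/

set_option linter.dupNamespace false -- tree convention: `Summit.BirchSwinnertonDyer.BirchSwinnertonDyer.Theorems` (summit = sub-problem)
set_option autoImplicit false

noncomputable section

open scoped Classical

namespace Summit.BirchSwinnertonDyer.BirchSwinnertonDyer.Theorems.GenusKolyArch

open WeierstrassCurve NumberField IsDedekindDomain Field
open Literature.NumberTheory.EllipticCurves Literature.NumberTheory.GaloisRepresentations
open Literature.Barriers.BirchSwinnertonDyer (Matsuno2009.primePlace)
open Summit.BirchSwinnertonDyer.Rank1Residual.F1Sign2 (selmerGroupRelaxedAtInfinityAtTwo DescAdmissible)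
open Rat.HeightOneSpectrum (primesEquiv)

/-! ## §206 The local condition at `K_w` for the restricted class is the local condition at the `ℚ`-field `K_w` -/

section Bridge

variable (W : WeierstrassCurve ℚ) (K : Type) [Field K] [NumberField K]

/-- **Bridge**: for `x ∈ H¹(ℚ, E[n])` and a finite place `w` of `K`, the restricted class `res_K x` satisfies the Selmer condition of
`E_K` at `K_w` iff `x` dies in `H¹(K_w, E)` for `K_w` viewed as a `ℚ`-field (`torsionH1ToH1_resTorsion` +
`mem_localRestrictionKer_iff_resBaseChange_mem` along the tower `ℚ → K → K_w`). [cite: SerreGaloisCohomology1997, I §2.4] -/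
theorem mem_selmerLocalKer_adicCompletion_iff_resTorsion_mem (n : ℤ) (w : HeightOneSpectrum (𝓞 K)) (x : galH1Torsion W n) :
    x ∈ selmerLocalKer W (w.adicCompletion K) n ↔
      resTorsion W K n x ∈ selmerLocalKer (W.baseChange K) (w.adicCompletion K) n := by
  haveI : IsScalarTower ℚ K (w.adicCompletion K) := IsScalarTower.of_algebraMap_eq fun q ↦ by
    rw [eq_ratCast (algebraMap ℚ (w.adicCompletion K)) q, eq_ratCast (algebraMap ℚ K) q, map_ratCast]
  rw [mem_selmerLocalKer_iff_torsionH1ToH1_mem, mem_selmerLocalKer_iff_torsionH1ToH1_mem, torsionH1ToH1_resTorsion,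
    ← mem_localRestrictionKer_iff_resBaseChange_mem]

/-- For `res_K x ∈ Sel^(n)(E_K/K)`: `x` dies in `H¹(K_w, E)` at every finite place `w` of `K`. [cite: SerreGaloisCohomology1997, I §2.4] -/
theorem forall_mem_selmerLocalKer_adicCompletion_of_resTorsion_mem_selmerGroup (n : ℤ) {x : galH1Torsion W n}
    (hx : resTorsion W K n x ∈ selmerGroup (W.baseChange K) n) (w : HeightOneSpectrum (𝓞 K)) :
    x ∈ selmerLocalKer W (w.adicCompletion K) n :=
  (mem_selmerLocalKer_adicCompletion_iff_resTorsion_mem W K n w x).mpr ((((W.baseChange K).mem_selmerGroup_iff n _).mp hx).1 w)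

end Bridge

/-! ## §207 Exact descent: the `K_w`-conditions at all finite `w` give the finite `ℚ_p`-conditions, for `K = ℚ(√d)`, `d` admissible -/

section ExactDescent

variable (W : WeierstrassCurve ℚ) [W.IsElliptic] [W.IsGloballyMinimal] (K : Type) [Field K] [NumberField K]

/-- Every finite place of `ℚ` is `primePlace p` for a prime `p`. [folklore] -/
theorem exists_eq_primePlace (v : HeightOneSpectrum (𝓞 ℚ)) : ∃ p : ℕ, p.Prime ∧ v = Matsuno2009.primePlace p := by
  refine ⟨(primesEquiv v : ℕ), (primesEquiv v).2, ?_⟩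
  rw [Matsuno2009.primePlace, dif_pos (primesEquiv v).2]
  exact (Equiv.symm_apply_apply primesEquiv v).symm

omit [W.IsGloballyMinimal] in
/-- **At a silent odd prime every class of `H¹(ℚ, E[2])` satisfies the Selmer condition**: `p` odd with `E(ℚ_p)[2] = 0` ⟹
`#H¹(ℚ_p, E[2]) = #E(ℚ_p)[2]² = 1` (Milne I 2.8 + 2.3, tree `natCard_galoisCohomology_one_torsion_adicCompletion_eq_sq_of_not_mem`), so
`res_p x = 0 ∈ 𝓛_p` for every `x` and every `ℚ`-field lying over `ℚ_p` is irrelevant. [cite: MilneADT2006, Ch. I, Cor. 2.3 and Thm. 2.8]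
[cite: MazurRubin2010, Lemma 2.11] -/
theorem mem_selmerLocalKer_of_natCard_ker_eq_one (v : HeightOneSpectrum (𝓞 ℚ)) (h2v : ((2 : ℕ) : 𝓞 ℚ) ∉ v.asIdeal)
    (h1 : Nat.card (nsmulAddMonoidHom 2 : (W.baseChange (v.adicCompletion ℚ)).toAffine.Point →+ _).ker = 1)
    (x : galH1Torsion W ((2 : ℕ) : ℤ)) : x ∈ selmerLocalKer W (v.adicCompletion ℚ) ((2 : ℕ) : ℤ) := by
  haveI : NeZero (2 : ℕ) := ⟨two_ne_zero⟩
  have hH : Nat.card (galoisCohomology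
      (GaloisRep.restrictField (v.adicCompletion ℚ) (W.torsionGaloisModule (2 : ℕ))) 1) = 1 := by
    rw [natCard_galoisCohomology_one_torsion_adicCompletion_eq_sq_of_not_mem W v 2 h2v, h1, one_pow]
  have hsub := (Nat.card_eq_one_iff_unique.mp hH).1
  apply mem_selmerLocalKer_of_mem_kummerLocalConditionAt_res
  have h0 : galoisCohomology.res (W.torsionGaloisModule ((2 : ℕ) : ℤ)) (v.adicCompletion ℚ) 1 x = 0 := Subsingleton.elim _ _
  rw [h0]
  exact AddSubgroup.zero_mem _

/-- **Exact descent of the finite `2`-Selmer conditions along an admissible imaginary quadratic field** (Kramer 1981, proof of Thm. 1;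
Dokchitser–Dokchitser, proof of Lemma 4.14, at the places where the local term vanishes). Let `W/ℚ` be globally minimal, `d`
descent-admissible (`F1Sign2.DescAdmissible W d`), `K ∋ √d` quadratic and `x ∈ H¹(ℚ, E[2])`. If `x` dies in `H¹(K_w, E)` for EVERY finite place
`w` of `K` (e.g. `res_K x ∈ Sel₂(E_K/K)`, §206) then `x ∈ Sel₂^{rel ∞}(W)` — it satisfies `W`'s Kummer condition at every finite place `p`
of `ℚ`: `p ∣ d` is odd, good and silent (`a_p` odd, `E(ℚ_p)[2] = 0`), so `H¹(ℚ_p, E[2]) = 0`; `p ∤ d` of good reduction is unramified in `K`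
(`d_K = d` odd), so the `K_w`- and `ℚ_p`-conditions coincide (gk2-p3's `selmerLocalKer_adicCompletion_eq_of_not_dvd_discr`, Milne I 3.8);
`p ∤ d` of bad reduction splits in `K` (`d ≡ 1 (8)` at `p = 2`, `(d/p) = 1` at odd `p`), so again the conditions coincide
(`selmerLocalKer_adicCompletion_eq_of_ncard_primesOver_eq_two`). [cite: Kramer1981, Thm. 1 (proof), Prop. 3] [cite: MilneADT2006, Ch. I Prop. 3.8]
[cite: DokchitserDokchitserAnnals2010, Lemma 4.14 (proof)] -/
theorem mem_selmerGroupRelaxedAtInfinityAtTwo_of_forall_mem_selmerLocalKer {d : ℤ} (hd : DescAdmissible W d)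
    (h2 : Module.finrank ℚ K = 2) {i : K} (hi : i ^ 2 = (d : K)) {x : galH1Torsion W ((2 : ℕ) : ℤ)}
    (hx : ∀ w : HeightOneSpectrum (𝓞 K), x ∈ selmerLocalKer W (w.adicCompletion K) ((2 : ℕ) : ℤ)) :
    x ∈ selmerGroupRelaxedAtInfinityAtTwo W := by
  obtain ⟨hdneg, hsf, hd8, hprimes, hbad⟩ := hd
  -- `d_K = d`, odd
  have hdK : NumberField.discr K = d :=
    Literature.NumberTheory.QuadraticFields.Quadratic.discr_eq_of_sq_eq_intCast_of_neg h2 hi hdneg (by omega) hsf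
  have hodd : Odd (NumberField.discr K) := by
    rw [hdK, Int.odd_iff]; omega
  refine AddSubgroup.mem_iInf.mpr fun v ↦ ?_
  obtain ⟨p, hp, rfl⟩ := exists_eq_primePlace v
  haveI := Fact.mk hp
  obtain ⟨w, hw⟩ := Literature.Barriers.BirchSwinnertonDyer.exists_heightOneSpectrum_liesOver K p
  haveI := hw
  have hpv : (p : 𝓞 ℚ) ∈ (Matsuno2009.primePlace p).asIdeal := Literature.Barriers.BirchSwinnertonDyer.Matsuno2009.natCast_mem_primePlace hp
  by_cases hpd : (p : ℤ) ∣ d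
  · -- a prime of `d`: odd, good, silent
    obtain ⟨hgood, hoddap⟩ := hprimes p hp hpd
    have hp2 : p ≠ 2 := by
      rintro rfl
      have : (2 : ℤ) ∣ d := hpd
      omega
    have hgood' : W.HasGoodReductionAtPrime p := hgood inferInstance
    have hpΔ : ¬ (p : ℤ) ∣ minimalDiscriminantInt W := W.not_dvd_minimalDiscriminantInt_of_hasGoodReductionAtPrime' _ hgood'
    have hsil := (GenusKolyTwin.silent_iff_odd_frobeniusTrace W hp2 hpΔ).mpr hoddap
    have h2v : ((2 : ℕ) : 𝓞 ℚ) ∉ (Matsuno2009.primePlace p).asIdeal :=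
      GenusKolyTwistingPrime.natCast_not_mem_of_not_dvd hp hpv fun h ↦
        hp2 ((Nat.prime_dvd_prime_iff_eq hp Nat.prime_two).mp h)
    have hker : Nat.card (nsmulAddMonoidHom 2 :
        (W.baseChange ((Matsuno2009.primePlace p).adicCompletion ℚ)).toAffine.Point →+ _).ker = 1 := by
      rw [natCard_ker_nsmul_adicCompletion_eq_padic W hpv 2]
      have h0 := GenusKolyTwin.twoTorsion_padic_eq_zero_of_forall_ne W hp2 hpΔ hsil
      rw [Nat.card_eq_one_iff_unique]
      refine ⟨⟨fun a b ↦ Subtype.ext ((h0 a.1 a.2).trans (h0 b.1 b.2).symm)⟩, ⟨⟨0, by simp⟩⟩⟩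
    exact mem_selmerLocalKer_of_natCard_ker_eq_one W _ h2v hker x
  · have hpdisc : ¬ (p : ℤ) ∣ NumberField.discr K := by rwa [hdK]
    by_cases hgood : W.HasGoodReductionAt (Matsuno2009.primePlace p)
    · -- unramified good: the conditions coincide
      rw [← GenusExact.PlusDescent.selmerLocalKer_adicCompletion_eq_of_not_dvd_discr W K w h2 hodd hp hpdisc hgood]
      exact hx w
    · -- bad, hence split
      have hbad' : ∀ _h : Fact p.Prime, ¬ W.HasGoodReductionAtPrime p := fun _ hg ↦ by
        have h1 : ¬ p ∣ W.conductorNorm ℤ := not_dvd_conductorNorm_of_hasGoodReductionAtPrime W hg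
        have h2' : (primesEquiv (Matsuno2009.primePlace p) : ℕ) ∣ W.conductorNorm ℤ := (W.dvd_conductorNorm_iff _).mpr hgood
        rw [Literature.Barriers.BirchSwinnertonDyer.Matsuno2009.primesEquiv_primePlace hp] at h2'
        exact h1 h2'
      have hsplit : ((Ideal.span {(p : ℤ)}).primesOver (𝓞 K)).ncard = 2 := by
        by_cases hp2 : p = 2
        · subst hp2
          rw [Nat.cast_ofNat, Literature.NumberTheory.QuadraticFields.Quadratic.ncard_primesOver_two_eq_two_iff h2, hdK]
          exact hd8
        · rw [Literature.NumberTheory.QuadraticFields.Quadratic.ncard_primesOver_eq_two_iff_jacobiSym h2 hp hp2, hdK]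
          exact hbad p hp hp2 hbad'
      rw [← GenusExact.PlusDescent.selmerLocalKer_adicCompletion_eq_of_ncard_primesOver_eq_two W K w h2 hp hsplit]
      exact hx w

/-- **`res_K x ∈ Sel₂(E_K/K) ⟹ x ∈ Sel₂^{rel ∞}(W)`** for `K ∋ √d`, `d` descent-admissible: the `Gal(K/ℚ)`-invariant part of `Sel₂(E_K/K)`
descends into the ∞-relaxed Selmer group of `W` (and conversely `res_K Sel₂^{rel ∞}(W) ⊆ Sel₂(E_K/K)`, file 47 §200). Kramer 1981, proof of Thm. 1.
[cite: Kramer1981, Thm. 1 (proof)] [cite: DokchitserDokchitserAnnals2010, Lemma 4.14 (proof)] -/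
theorem mem_selmerGroupRelaxedAtInfinityAtTwo_of_resTorsion_mem_selmerGroup {d : ℤ} (hd : DescAdmissible W d)
    (h2 : Module.finrank ℚ K = 2) {i : K} (hi : i ^ 2 = (d : K)) {x : galH1Torsion W ((2 : ℕ) : ℤ)}
    (hx : resTorsion W K ((2 : ℕ) : ℤ) x ∈ selmerGroup (W.baseChange K) ((2 : ℕ) : ℤ)) :
    x ∈ selmerGroupRelaxedAtInfinityAtTwo W :=
  mem_selmerGroupRelaxedAtInfinityAtTwo_of_forall_mem_selmerLocalKer W K hd h2 hi
    (forall_mem_selmerLocalKer_adicCompletion_of_resTorsion_mem_selmerGroup W K _ hx)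

end ExactDescent

end Summit.BirchSwinnertonDyer.BirchSwinnertonDyer.Theorems.GenusKolyArch

end
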